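import Summits.BirchSwinnertonDyer.BirchSwinnertonDyer.Theorems.ManinLocalTwoThreeWildThreeTorsionAscent
import HarnessLib

/-!
# The two Kodaira position laws T3III / T3W of line `kato_shift_three` v16 follow BY NAME from NB₃^V, from an's E-an-100₉
# and from an's E-an-99 (ASCμ₃) — the Stevens-ledger rows feed both residual stubs

Summit `BirchSwinnertonDyer`, route `ManinLocalTwoThree` (cell bsd-f2-manin), deciding crux C3 `ManinPrimeToThreeAtNine`
(stmt-BirchSwinnertonDyer-22968), line `kato_shift_three`, skeleton v16 (lead p1 gen 7, registered): the residual of the old stub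
NB₃^V `NoAscendingThreeTorsionOptimal` is the pair of Kodaira POSITION LAWS for `X₀(N)`-optimal curves carrying a rational point of
order `3` on `E♮` — T3III (tame: type `III`; an's E-an-112) and T3W (wild: `ord₃ Δ_min ∉ {5, 11}`), spelled out inline in the
skeleton until the typer names them.  `…TameThreeTorsionAscends` proved T3III ⟸ NB₃^V and T3III ⟸ E-an-100₉; THIS FILE adds the wild
twins and the E-an-99 versions, so that EACH of an's Stevens-ledger rows E-an-99 `OptimalAscendingThreeKernelIsMu` ⟹ E-an-100 ⟹
E-an-100₉ `NoConstantKernelAscendingThreeOptimalAtNine` ⟹ NB₃^V (tree edges p648978) feeds BOTH v16 stubs by name: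

* `wildPositionLaw_of_noAscendingThreeTorsionOptimal` — T3W ⟸ NB₃^V;
* `wildPositionLaw_of_noConstantKernelAscendingAtNine` — T3W ⟸ E-an-100₉;
* `positionLaws_of_optimalAscendingThreeKernelIsMu` — T3III ∧ T3W ⟸ E-an-99 (ASCμ₃: «an optimal curve ascends at `3` only
  through `μ₃`»).

HONEST FRAMING: implications between OPEN `c`-free laws; nothing about C3, Manin's conjecture or BSD is proved.  No definitions,
no named facts, no sorry.
References: [Stevens1989] §2 (shape only); [Vatsal2005] Conj. 1.9 (shape only); HOME/MEMO-an.md §64, §66–§67.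
-/

set_option linter.dupNamespace false
set_option autoImplicit false

noncomputable section

open scoped Classical

open WeierstrassCurve IsDedekindDomain NumberField Rat.HeightOneSpectrum Polynomial
  Literature.NumberTheory.DiophantineGeometry Literature.NumberTheory.EllipticCurves
  Literature.NumberTheory.EllipticCurves.ModularForms
  Summit.BirchSwinnertonDyer.Rank1Residual.Additive
  Summit.BirchSwinnertonDyer.Rank1Residual.ManinAdditive
  Summit.BirchSwinnertonDyer.Rank1Residual.ManinAdditive.CuspidalKummer
  Summit.BirchSwinnertonDyer.Rank1Residual.ManinAdditive.CuspidalKummerThree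
  Summit.BirchSwinnertonDyer.Rank1Residual.ManinAdditive.ThreeIsogenyKernel

namespace Summit.BirchSwinnertonDyer.BirchSwinnertonDyer.Theorems.ManinLocalTwoThree

/-- **T3W ⟸ NB₃^V** (the v14 stub BY NAME implies the v16 wild stub): restrict `NoAscendingThreeTorsionOptimal` to `27 ∣ N(W)`
and apply `noAscendingWild_iff_wildPositionLaw`. [cite: SilvermanATAEC1994, IV.9.4 Table 4.1] -/
theorem wildPositionLaw_of_noAscendingThreeTorsionOptimal (h : NoAscendingThreeTorsionOptimal) :
    ∀ (W : WeierstrassCurve ℚ) [W.IsElliptic] [W.IsGloballyMinimal] {N : ℕ} [NeZero N]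
      (D : ModularParametrizationData W N),
      (∀ z ∈ D.L.lattice, ∃ w ∈ periodLattice D.f, z = D.c * w) → 9 ∣ N → 3 ^ 3 ∣ W.conductorNorm ℤ →
      ∀ X₁ Y₁ : ℚ, IsShortThreeTorsion W 1 X₁ Y₁ →
        padicValInt 3 W.minimalDiscriminantInt ≠ 5 ∧ padicValInt 3 W.minimalDiscriminantInt ≠ 11 :=
  noAscendingWild_iff_wildPositionLaw.mp (fun W _ _ _N _ D hL h9 _ X₁ Y₁ hT ↦ h W D hL h9 X₁ Y₁ hT)

/-- **T3W ⟸ E-an-100₉** (`ThreeIsogenyKernel.NoConstantKernelAscendingThreeOptimalAtNine`, BY NAME), through NB₃^V ⟸ E-an-100₉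
(`noAscendingThreeTorsionOptimal_of_noConstantKernelAscendingAtNine`, p648978).
[cite: Stevens1989, Thm. 2.3 (shape only: the rows are the cell's, implied on paper by Stevens' Conjecture II)] -/
theorem wildPositionLaw_of_noConstantKernelAscendingAtNine (h100 : NoConstantKernelAscendingThreeOptimalAtNine) :
    ∀ (W : WeierstrassCurve ℚ) [W.IsElliptic] [W.IsGloballyMinimal] {N : ℕ} [NeZero N]
      (D : ModularParametrizationData W N),
      (∀ z ∈ D.L.lattice, ∃ w ∈ periodLattice D.f, z = D.c * w) → 9 ∣ N → 3 ^ 3 ∣ W.conductorNorm ℤ →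
      ∀ X₁ Y₁ : ℚ, IsShortThreeTorsion W 1 X₁ Y₁ →
        padicValInt 3 W.minimalDiscriminantInt ≠ 5 ∧ padicValInt 3 W.minimalDiscriminantInt ≠ 11 :=
  wildPositionLaw_of_noAscendingThreeTorsionOptimal (noAscendingThreeTorsionOptimal_of_noConstantKernelAscendingAtNine h100)

/-- **T3III ∧ T3W ⟸ E-an-99 ASCμ₃** (`ThreeIsogenyKernel.OptimalAscendingThreeKernelIsMu`: «an `X₀(N)`-optimal curve ascends at
`3` only through `μ₃`», BY NAME), through an's proved chain E-an-99 ⟹ E-an-100 ⟹ E-an-100₉ ⟹ NB₃^V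
(`noAscendingThreeTorsionOptimal_of_optimalAscendingThreeKernelIsMu`, p648978) and the two restrictions.
[cite: Vatsal2005, Conj. 1.9 (shape only: the laws are the cell's E-an-99/100, implied by Stevens' Conjecture II)] -/
theorem positionLaws_of_optimalAscendingThreeKernelIsMu (h99 : OptimalAscendingThreeKernelIsMu) :
    (∀ (W : WeierstrassCurve ℚ) [W.IsElliptic] [W.IsGloballyMinimal] {N : ℕ} [NeZero N]
        (D : ModularParametrizationData W N),
        (∀ z ∈ D.L.lattice, ∃ w ∈ periodLattice D.f, z = D.c * w) → 9 ∣ N →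
        3 ^ 2 ∣ W.conductorNorm ℤ → ¬ 3 ^ 3 ∣ W.conductorNorm ℤ →
          ∀ X₁ Y₁ : ℚ, IsShortThreeTorsion W 1 X₁ Y₁ → padicValInt 3 W.minimalDiscriminantInt = 3) ∧
      (∀ (W : WeierstrassCurve ℚ) [W.IsElliptic] [W.IsGloballyMinimal] {N : ℕ} [NeZero N]
        (D : ModularParametrizationData W N),
        (∀ z ∈ D.L.lattice, ∃ w ∈ periodLattice D.f, z = D.c * w) → 9 ∣ N → 3 ^ 3 ∣ W.conductorNorm ℤ →
        ∀ X₁ Y₁ : ℚ, IsShortThreeTorsion W 1 X₁ Y₁ →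
          padicValInt 3 W.minimalDiscriminantInt ≠ 5 ∧ padicValInt 3 W.minimalDiscriminantInt ≠ 11) :=
  have hV : NoAscendingThreeTorsionOptimal := noAscendingThreeTorsionOptimal_of_optimalAscendingThreeKernelIsMu h99
  ⟨typeIIILaw_of_noAscendingThreeTorsionOptimal hV, wildPositionLaw_of_noAscendingThreeTorsionOptimal hV⟩

end Summit.BirchSwinnertonDyer.BirchSwinnertonDyer.Theorems.ManinLocalTwoThree

end
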